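import Literature.NumberTheory.EllipticCurves.BSDSelmer
import Literature.NumberTheory.EllipticCurves.BSDRootNumberModularityOnlyProofs
import HarnessLib

/-!
# bsd.S19: the two forms of the `p`-parity theorem are one theorem modulo the functional equation
(proofs for `Literature.NumberTheory.EllipticCurves.BSDSelmer`)

D-0014 keeps `Literature/` sorry-free by stating cited results as named facts `def X : Prop`.
`BSDSelmer` states the `p`-parity theorem of T. and V. Dokchitser (*On the Birch–Swinnerton-Dyer
quotients modulo squares*, Ann. of Math. 172 (2010), Thm. 1.4 = Thm. 4.19) in two forms, for an
elliptic `W / ℚ` and a prime `p`: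

* `p_parity W p` — `(-1)^{corank_{ℤ_p} Sel_{p^∞}(E/ℚ)} = w(E)` (the form of Conjecture 1.2 there,
  with the analytic root number `WeierstrassCurve.rootNumber`);
* `selmerCorank_mod_two_eq W p` — `corank_{ℤ_p} Sel_{p^∞}(E/ℚ) ≡ ord_{s=1} L(E, s) (mod 2)`, which
  is *verbatim* the displayed statement of Thm. 4.19 (§4.6, "For every elliptic curve `E/ℚ` and
  every prime `p`, `rk_p(E/ℚ) ≡ ord_{s=1} L(E, s) mod 2`") and of the abstract ("the parities of
  the `p^∞`-Selmer rank and the analytic rank agree").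

The passage between them is the parity consequence of the functional equation,
`Even (ord_{s=1} L(E, s)) ↔ w(E) = 1` (prelude fact `WeierstrassCurve.even_analyticRank_iff`,
Silverman *AEC* C.16, remark after Thm. 16.3), which the tree proves from the Modularity Theorem
alone (`even_analyticRank_iff_rootNumber_eq_one_of_exists_isNewformOf`,
`BSDRootNumberModularityOnlyProofs`). This file proves that passage in both directions:

* `selmerCorank_mod_two_eq_iff_p_parity` — given `W.even_analyticRank_iff`, the two facts are
  equivalent (pure sign algebra, `w(E) ∈ {±1}`); one-directional forms
  `selmerCorank_mod_two_eq_of_p_parity`, `p_parity_of_selmerCorank_mod_two_eq`;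
* `selmerCorank_mod_two_eq_iff_p_parity_of_exists_isNewformOf` and the two one-directional
  forms — the same with the parity input replaced by its source, the Modularity Theorem
  `Literature.NumberTheory.EllipticCurves.ModularForms.exists_isNewformOf`
  (Breuil–Conrad–Diamond–Taylor 2001, Thm. A).

Only theorems are added; no definition and no statement of `BSDSelmer` is changed. The sibling
file `BSDSelmerParityDokchitserProofs` decomposes `selmerCorank_mod_two_eq` itself along the
printed proof of Thm. 4.19.

## Why `selmerCorank_mod_two_eq_holds` / `p_parity_holds` are not here

Both facts are as strong as (i) the Modularity Theorem — `W.analyticRank` is the order at `s = 1`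
of the *entire continuation* of `L(E, s)` and `W.rootNumber` the sign of a functional equation,
both junk without a continuation, exactly as for `even_analyticRank_iff_rootNumber_eq_one_holds`
("Why … is still not here", `BSDRootNumberModularityOnlyProofs`) — and (ii) the `p`-parity
theorem proper, whose printed proof (Dokchitser–Dokchitser 2010, §4.6) rests on Monsky 1996
(`p = 2`), the non-vanishing theorems of Bump–Friedberg–Hoffstein / Murty–Murty / Waldspurger,
Kolyvagin's theorem, and — over the anticyclotomic tower of a Heegner field — Cornut–Vatsal and
Tian–Zhang / Nekovář together with the authors' Prop. 4.17; none of these is formalised. The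
facts are therefore reduced, not discharged; they are not mis-stated and are not weakened.

## References

* T. Dokchitser, V. Dokchitser, *On the Birch–Swinnerton-Dyer quotients modulo squares*, Ann. of
  Math. 172 (2010), 567–596 = arXiv:math/0610290: Conj. 1.2, Thm. 1.4 = Thm. 4.19 (§4.6), abstract.
* J. H. Silverman, *The Arithmetic of Elliptic Curves*, 2nd ed., GTM 106 (2009), C.16, Thm. 16.3
  and the remark following it (p. 451).
* C. Breuil, B. Conrad, F. Diamond, R. Taylor, J. Amer. Math. Soc. 14 (2001), Thm. A.
-/

noncomputable section

open WeierstrassCurve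

namespace Literature.NumberTheory.EllipticCurves

variable (W : WeierstrassCurve ℚ) [W.IsElliptic] (p : ℕ)

/-! The bodies of `p_parity W p` and `selmerCorank_mod_two_eq W p` mention neither `[W.IsElliptic]`
nor `[Fact p.Prime]` (they are predicates in `W` and `p`); the sign algebra below holds for every
`p : ℕ`, and `[W.IsElliptic]` enters only through the parity hypothesis. -/

/-- **The two bsd.S19 facts are equivalent given the parity of the analytic rank.** If
`Even (ord_{s=1} L(E, s)) ↔ w(E) = 1` (`W.even_analyticRank_iff`, the functional equation at the
centre; Silverman AEC C.16, p. 451), then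
`corank Sel_{p^∞}(E/ℚ) ≡ ord_{s=1} L(E, s) (mod 2)` iff `(-1)^{corank Sel_{p^∞}(E/ℚ)} = w(E)`:
both say that the Selmer corank has the parity singled out by the sign `w(E) ∈ {±1}`
(`WeierstrassCurve.rootNumber_eq_one_or`). This is how Dokchitser–Dokchitser 2010 pass between
Conjecture 1.2 (`rk_p(E/K)` even iff `w(E/K) = 1`) and the displayed form of Thm. 4.19.
[cite: DokchitserDokchitserAnnals2010, Conj. 1.2 and Thm. 4.19 (= Thm. 1.4)] -/
theorem selmerCorank_mod_two_eq_iff_p_parity (hpar : W.even_analyticRank_iff) :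
    selmerCorank_mod_two_eq W p ↔ p_parity W p := by
  have h' : Even W.analyticRank ↔ W.rootNumber = 1 := hpar
  have hne : (-1 : ℤ) ≠ 1 := by decide
  unfold selmerCorank_mod_two_eq p_parity
  rcases W.analyticRank.even_or_odd with he | ho
  · rw [h'.mp he, Nat.even_iff.mp he, neg_one_pow_eq_one_iff_even hne, Nat.even_iff]
  · have hw : W.rootNumber = -1 := by
      rcases W.rootNumber_eq_one_or with h1 | h1
      · exact absurd (h'.mpr h1) (Nat.not_even_iff_odd.mpr ho)
      · exact h1
    rw [hw, Nat.odd_iff.mp ho, neg_one_pow_eq_neg_one_iff_odd hne, Nat.odd_iff]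

/-- `p_parity W p` ⟹ `selmerCorank_mod_two_eq W p`, given the parity of the analytic rank
(`W.even_analyticRank_iff`): the deduction of the displayed form of Dokchitser–Dokchitser 2010,
Thm. 4.19, from Conjecture 1.2 for `E/ℚ`. [cite: DokchitserDokchitserAnnals2010, Conj. 1.2 and Thm. 4.19 (= Thm. 1.4)] -/
theorem selmerCorank_mod_two_eq_of_p_parity (hpar : W.even_analyticRank_iff) (h : p_parity W p) :
    selmerCorank_mod_two_eq W p :=
  (selmerCorank_mod_two_eq_iff_p_parity W p hpar).mpr h

/-- `selmerCorank_mod_two_eq W p` ⟹ `p_parity W p`, given the parity of the analytic rank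
(`W.even_analyticRank_iff`): Thm. 4.19 of Dokchitser–Dokchitser 2010 in the form of their
Conjecture 1.2 (`rk_p(E/ℚ)` is even iff `w(E/ℚ) = 1`), which is how Thm. 1.4 is worded.
[cite: DokchitserDokchitserAnnals2010, Conj. 1.2 and Thm. 1.4] -/
theorem p_parity_of_selmerCorank_mod_two_eq (hpar : W.even_analyticRank_iff)
    (h : selmerCorank_mod_two_eq W p) : p_parity W p :=
  (selmerCorank_mod_two_eq_iff_p_parity W p hpar).mp h

/-- **The two bsd.S19 facts are equivalent given the Modularity Theorem alone**: the parity input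
`W.even_analyticRank_iff` of `selmerCorank_mod_two_eq_iff_p_parity` is the tree theorem
`even_analyticRank_iff_rootNumber_eq_one_of_exists_isNewformOf` (functional equation of
`Λ(E, s)` from the attached newform via Hecke and Atkin–Lehner, `L(E, ·) ≢ 0`, comparison of
Taylor expansions at `s = 1`; `BSDRootNumberModularityOnlyProofs`) fed with
`Literature.NumberTheory.EllipticCurves.ModularForms.exists_isNewformOf` (BCDT 2001, Thm. A).
[cite: DokchitserDokchitserAnnals2010, Conj. 1.2 and Thm. 4.19 (= Thm. 1.4)] [cite: BCDTJAMS2001, Thm. A] -/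
theorem selmerCorank_mod_two_eq_iff_p_parity_of_exists_isNewformOf
    (hmod : Literature.NumberTheory.EllipticCurves.ModularForms.exists_isNewformOf) :
    selmerCorank_mod_two_eq W p ↔ p_parity W p :=
  selmerCorank_mod_two_eq_iff_p_parity W p
    (even_analyticRank_iff_rootNumber_eq_one_of_exists_isNewformOf W hmod)

/-- `p_parity W p` ⟹ `selmerCorank_mod_two_eq W p` given the Modularity Theorem
(`exists_isNewformOf`, BCDT 2001, Thm. A): so the target fact `selmerCorank_mod_two_eq` rests on
exactly two named facts, `p_parity` (Dokchitser–Dokchitser 2010, Thm. 1.4) and modularity.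
[cite: DokchitserDokchitserAnnals2010, Thm. 1.4 and Thm. 4.19] [cite: BCDTJAMS2001, Thm. A] -/
theorem selmerCorank_mod_two_eq_of_p_parity_of_exists_isNewformOf
    (hmod : Literature.NumberTheory.EllipticCurves.ModularForms.exists_isNewformOf)
    (h : p_parity W p) : selmerCorank_mod_two_eq W p :=
  (selmerCorank_mod_two_eq_iff_p_parity_of_exists_isNewformOf W p hmod).mpr h

/-- `selmerCorank_mod_two_eq W p` ⟹ `p_parity W p` given the Modularity Theorem
(`exists_isNewformOf`, BCDT 2001, Thm. A). [cite: DokchitserDokchitserAnnals2010, Thm. 1.4 and Thm. 4.19] [cite: BCDTJAMS2001, Thm. A] -/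
theorem p_parity_of_selmerCorank_mod_two_eq_of_exists_isNewformOf
    (hmod : Literature.NumberTheory.EllipticCurves.ModularForms.exists_isNewformOf)
    (h : selmerCorank_mod_two_eq W p) : p_parity W p :=
  (selmerCorank_mod_two_eq_iff_p_parity_of_exists_isNewformOf W p hmod).mp h

end Literature.NumberTheory.EllipticCurves

end
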